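import Summits.BirchSwinnertonDyer.BirchSwinnertonDyer.Theorems.EisensteinPrimesMazurMCOnCellBMuPartTight
import Summits.BirchSwinnertonDyer.Rank1Residual.X2.LambdaParity
import HarnessLib

/-!
# Crux `MazurMCOnCellB` (stmt-BirchSwinnertonDyer-19033), line `mudescent` v3: the TIGHT form in the
# PARITY shape of the re-cut λ-stub — at an X2b pair Mazur's main conjecture ⟺ (μ-part ∧ parity
# λ-count) (helper; closes nothing; route-independent imports)

Cell `bsd-eis`, D-0154 width seat `bsd-line-x2-p1-w2` (gen 2), crux 3 (row A10, X2b). The LEAD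
(bsd-line-x2-p1) re-cut the skeleton of record to v3 (`Cruxes/MazurMCOnCellB/Lines/mudescent.lean`,
2026-08-28): stub 1b `stub_prop310` (Greenberg 1999 Prop. 3.10, FACT), stub 3 unchanged
(`stub_analyticMuZero_offLocus`), stub 4 in PARITY form `stub_lambdaCountParity_offLocus`
(`∃ n k, λ_an = n ∧ λ_alg ≥ k ∧ (¬split → n ≤ k + 1 ∧ Even n) ∧ (split → n ≤ k + 2 ∧ Odd n)`),
composed by `X2.mazurMainConjectureAt_of_algebraicLambdaGE_of_parity`. This file is the parity twin of
`EisensteinPrimesMazurMCOnCellBMuPartTight` (same seat, v2 shape): it replaces the `μ_an = 0` input of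
the parity route T by the μ-PART `μ(ϖ·L) ≤ μ(char X)` (inline, as there), so that the v3 stubs can be
compared with the crux exactly.

* §1 `mazurMainConjectureAt_of_muPart_of_lambdaCountParity` — route T at `p ‖ N`, μ-TOLERANT, WITH
  PARITY (`r_an ≤ 1`): Wuthrich Thm. 16 (`hWu`), Prop. 3.10 (`h310`), GZK (`hGZK`), `ϖ·L ≠ 0`,
  μ-part, `λ_an = n`, `λ_alg ≥ k`, `n ≤ k + e + 1`, `n ≡ r_an + e (mod 2)` ⇒ `X2.MazurMainConjectureAt`
  (`g = u·h·f_E`: `μ(h) = 0` from the μ-part, `λ(h) = n − e − λ(f_E) ≤ 1` and even, hence `0`).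
* §2 `cellB_mazurMainConjectureAt_iff_muPart_and_lambdaCountParity` — AT AN X2b PAIR:
  `X2.MazurMainConjectureAt W p ⟺ μ-part ∧ (stub 4 v3's conclusion at the pair)`; `→` uses the
  converses of file 2 (`muPart_of_mazurMainConjectureAt`,
  `exists_lambdaCount_of_mazurMainConjectureAt_of_analyticRank_eq_zero`) and the functional-equation
  parity `X2.analyticLambdaEq_parity` (b2b gen 6, a THEOREM given `hWu hpar` and the non-vanishing of
  file 1). The class-wide form by the crux's name is in `…MuPartTightCrux`.

HONEST FRAMING: theorems only (no `def`, no named fact, no `sorry`); nothing here proves the crux, a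
stub or BSD for any curve; 0 cells / 0 labels move; the skeleton is not re-registered by this seat.
References: [GreenbergLNM1716] Prop. 3.10, Cor. 5.6 (p. 136), §5 p. 183; [MazurTateTeitelbaum1986]
§I.17–I.18; [Wuthrich2014] Thm. 16 (p. 397); [GreenbergVatsal2000] p. 4 (after Thm. (1.2)).
-/

set_option autoImplicit false

-- `Summit.BirchSwinnertonDyer.BirchSwinnertonDyer.…`: the summit and its single sub-problem share a name (D-0017 layout).
set_option linter.dupNamespace false

noncomputable section

open scoped Classical MatrixGroups ModularForm

open PowerSeries CongruenceSubgroup WeierstrassCurve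
  Literature.NumberTheory.EllipticCurves
  Literature.NumberTheory.EllipticCurves.ModularForms
  Literature.NumberTheory.EllipticCurves.Rank1Residual
  Literature.NumberTheory.EllipticCurves.Wuthrich2014
  Literature.NumberTheory.EllipticCurves.Greenberg1999
  Summit.BirchSwinnertonDyer.Rank1Residual
  Summit.BirchSwinnertonDyer.Rank1Residual.X1.MuLambda
  Summit.BirchSwinnertonDyer.Rank1Residual.X1.MuPart
  Summit.BirchSwinnertonDyer.Rank1Residual.X1.ParitySqueeze
  Summit.BirchSwinnertonDyer.Rank1Residual.X1.TamagawaSqueeze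
  Summit.BirchSwinnertonDyer.BirchSwinnertonDyer.Theorems.EisensteinPrimesX2AnalyticMuBound
  Summit.BirchSwinnertonDyer.BirchSwinnertonDyer.Theorems.EisensteinPrimesMazurMCOnCellBMuPartTight

namespace Summit.BirchSwinnertonDyer.BirchSwinnertonDyer.Theorems.EisensteinPrimesMazurMCOnCellBMuPartTightParity

variable {W : WeierstrassCurve ℚ} [W.IsElliptic] [W.IsGloballyMinimal] {p : ℕ} [Fact p.Prime]

/-! ## §1. Route T at `p ‖ N`, μ-tolerant, with parity -/

/-- **Route T at an odd multiplicative Eisenstein prime, μ-TOLERANT, WITH PARITY (analytic rank `≤ 1`).**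
As `EisensteinPrimesMazurMCOnCellBMuPartTight.mazurMainConjectureAt_of_muPart_of_lambdaCount`, with the
weaker bounds `n ≤ k + 1` (non-split) / `n ≤ k + 2` (split) and the parity of the datum (`n + r_an`
even at a non-split prime, odd at a split prime). PUBLISHED named facts (hypotheses): Wuthrich 2014
Thm. 16 (`hWu`), Greenberg 1999 Prop. 3.10 (`h310`: `corank Sel_{p^∞}(E/ℚ) ≡ λ(X) (mod 2)`),
Gross–Zagier–Kolyvagin (`hGZK`: the corank is `r_an`). Data: `∃ m, X2.AnalyticMuLE W p m` (`ϖ·L ≠ 0`;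
a theorem at `r_an = 0`), the μ-part (inline), `X2.AnalyticLambdaEq W p n`, `AlgebraicLambdaGE W p k`.
Then `g = u·h·f_E` has `μ(h) = 0` (μ-part) and `λ(h) = n − e − λ(f_E) ≤ 1` even, hence `0`: `h ∈ Λˣ`.
The tree's `X2.mazurMainConjectureAt_of_algebraicLambdaGE_of_parity` is the case `μ(ϖ·L) = 0`.
[cite: GreenbergLNM1716, Prop. 3.10, Cor. 5.6 (proof, p. 136), §5 p. 183] [cite: Wuthrich2014, Thm. 16 and §5 (p. 397)]
[cite: GreenbergVatsal2000, p. 4 (after Thm. (1.2))] -/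
theorem mazurMainConjectureAt_of_muPart_of_lambdaCountParity
    (hWu : thm16_charIdeal_dvd_multiplicative_of_reducible)
    (h310 : prop310_selmerCorank_mod_two_eq_lambdaInvariant)
    (hGZK : rank_eq_analyticRank_of_analyticRank_le_one)
    (W : WeierstrassCurve ℚ) [W.IsElliptic] [W.IsGloballyMinimal] (p : ℕ) [Fact p.Prime]
    (hp2 : p ≠ 2) (hmult : W.HasMultiplicativeReductionAtPrime p)
    (hred : ¬ W.HasIrreducibleModPGaloisRep p) (hr : W.analyticRank ≤ 1)
    (hL0 : ∃ m : ℕ, X2.AnalyticMuLE W p m)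
    (hμ : ∀ (κ : ZpExtension ℚ p) (γ : Field.absoluteGaloisGroup ℚ),
      κ.IsCyclotomic → κ.IsTopGenerator γ → IsCyclotomicVariable p γ →
      ∀ {N : ℕ} [NeZero N] (f : CuspForm (Gamma0 N) 2), IsNewformOf W f →
      ∀ (ϖ : ℚ), (ϖ : ℝ) * W.realPeriodRat = plusPeriod f →
      ∀ (L : PowerSeries ℚ_[p]),
        (W.HasSplitMultiplicativeReductionAtPrime p → IsSplitMultPAdicLFunctionOf f p L) →
        (¬ W.HasSplitMultiplicativeReductionAtPrime p → IsMultPAdicLFunctionOf f p (-1) L) →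
      ∀ (D : W.SelmerDualData κ γ) (g G : IwasawaAlgebra p), D.charIdeal = Ideal.span {g} →
        iwasawaToPowerSeries p G = PowerSeries.C ((ϖ : ℚ) : ℚ_[p]) * L → mu G ≤ mu g)
    {n k : ℕ} (hlam : X2.AnalyticLambdaEq W p n) (halg : AlgebraicLambdaGE W p k)
    (hkN : ¬ W.HasSplitMultiplicativeReductionAtPrime p → n ≤ k + 1 ∧ Even (n + W.analyticRank))
    (hkS : W.HasSplitMultiplicativeReductionAtPrime p → n ≤ k + 2 ∧ Odd (n + W.analyticRank)) :
    X2.MazurMainConjectureAt W p := by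
  intro κ γ hκ hγ hγ' N _ f hf D ϖ hϖ
  haveI : Module.Finite (IwasawaAlgebra p) D.X := D.module_finite_holds hγ
  obtain ⟨m, hLm⟩ := hL0
  -- Wuthrich Thm. 16 at this datum; a generator `fE` of the characteristic ideal
  obtain ⟨hX, hKns, hKs⟩ := hWu W p hp2 hmult hred hκ hγ hγ' hf D ϖ hϖ
  haveI : (Literature.NumberTheory.EllipticCurves.Module.charIdeal (IwasawaAlgebra p) D.X).IsPrincipal :=
    charIdeal_isPrincipal_holds p D.X
  obtain ⟨fE, hfE⟩ := Submodule.IsPrincipal.principal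
    (Literature.NumberTheory.EllipticCurves.Module.charIdeal (IwasawaAlgebra p) D.X)
  have hchar : D.charIdeal = Ideal.span {fE} := hfE
  -- Gross–Zagier–Kolyvagin: `Ш` finite, `corank Sel_{p^∞}(E/ℚ) = rank E(ℚ) = r_an`
  obtain ⟨hrank, hfinsha⟩ := hGZK W hr
  haveI : Finite W.sha := hfinsha
  have hfinp : Finite (AddCommGroup.primaryComponent W.sha p) := inferInstance
  have hcork : W.selmerCorank p = W.analyticRank := by
    rw [selmerCorank_eq_mordellWeilRank_of_finite_shaPrimary W p hfinp, hrank]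
  -- the lower bound and the parity of `λ(fE) = λ(X)` (Prop. 3.10)
  have hkfE : fE ≠ 0 → k ≤ lam fE ∧ lam fE % 2 = W.analyticRank % 2 := fun hfE0 ↦ by
    rw [lam_generator_eq_lambdaInvariant D.X hX hfE0 hchar, ← hcork]
    exact ⟨halg κ γ hκ hγ D hX, (h310 W p hp2 κ γ hκ hγ D hX).symm⟩
  -- how the data at `G = u · (h · fE)` finish (`u = T` or `u = 1`)
  have finish : ∀ (u h : IwasawaAlgebra p) (e : ℕ) (L : PowerSeries ℚ_[p]), u ≠ 0 → lam u = e →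
      mu u = 0 →
      (W.HasSplitMultiplicativeReductionAtPrime p → IsSplitMultPAdicLFunctionOf f p L) →
      (¬ W.HasSplitMultiplicativeReductionAtPrime p → IsMultPAdicLFunctionOf f p (-1) L) →
      iwasawaToPowerSeries p (u * (h * fE)) = PowerSeries.C ((ϖ : ℚ) : ℚ_[p]) * L →
      lam (u * (h * fE)) = n → n ≤ k + e + 1 → Even (n + e + W.analyticRank) → IsUnit h := by
    intro u h e L hu0 hlu hμu hLs hLn hG hlG hnk hpar
    obtain ⟨k', hk'⟩ := hLm f hf ϖ hϖ L hLs hLn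
    have hL0' : PowerSeries.C ((ϖ : ℚ) : ℚ_[p]) * L ≠ 0 := X2.ne_zero_of_lt_norm_coeff hk'
    have hG0 : u * (h * fE) ≠ 0 := by
      intro h0; apply hL0'; rw [← hG, h0, map_zero]
    have hh0 : h ≠ 0 := fun h0 ↦ hG0 (by rw [h0, zero_mul, mul_zero])
    have hfE0 : fE ≠ 0 := fun h0 ↦ hG0 (by rw [h0, mul_zero, mul_zero])
    -- μ-part: `μ(u·h·fE) ≤ μ(fE)`, so `μ(h) = 0`
    have hμG : mu (u * (h * fE)) ≤ mu fE := hμ κ γ hκ hγ hγ' f hf ϖ hϖ L hLs hLn D fE _ hchar hG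
    rw [mu_mul hu0 (mul_ne_zero hh0 hfE0), mu_mul hh0 hfE0, hμu] at hμG
    have hμh : mu h = 0 := by omega
    -- parity λ-count: `e + λ(h) + λ(fE) = n ≤ k + e + 1 ≤ λ(fE) + e + 1`, `λ(h)` even, so `0`
    rw [lam_mul hu0 (mul_ne_zero hh0 hfE0), lam_mul hh0 hfE0, hlu] at hlG
    obtain ⟨hk, hmod⟩ := hkfE hfE0
    have hlh : lam h = 0 := by
      rcases Nat.even_or_odd (lam fE) with hev | hod
      · rw [Nat.even_iff] at hev
        rcases hpar with ⟨j, hj⟩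
        omega
      · rw [Nat.odd_iff] at hod
        rcases hpar with ⟨j, hj⟩
        omega
    exact (isUnit_iff_mu_eq_zero_and_lam_eq_zero h).mpr ⟨hh0, hμh, hlh⟩
  refine ⟨hX, fE, hchar, fun hsplit L hL => ?_, fun hns L hL => ?_⟩
  · -- SPLIT `p`: `λ(T·h·fE) = n ≤ k + 2`, `n + r_an` odd
    obtain ⟨hk2, hodd⟩ := hkS hsplit
    obtain ⟨g, hgmem, hιg⟩ := hKs hsplit L hL
    have hgmem' : g ∈ Ideal.span {fE} := by rw [← hchar]; exact hgmem
    obtain ⟨h, hgh⟩ := Ideal.mem_span_singleton'.mp hgmem'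
    have hG : iwasawaToPowerSeries p (PowerSeries.X * (h * fE)) =
        PowerSeries.C ((ϖ : ℚ) : ℚ_[p]) * L := by rw [hgh]; exact hιg
    have hlG : lam (PowerSeries.X * (h * fE)) = n :=
      hlam f hf ϖ hϖ L (fun _ ↦ hL) (fun hns ↦ absurd hsplit hns) _ hG
    have hpar : Even (n + 1 + W.analyticRank) := by
      rw [add_right_comm]; exact hodd.add_one
    have hunit : IsUnit h := finish PowerSeries.X h 1 L PowerSeries.X_ne_zero X2.lam_X
      X2.mu_X_eq_zero_and_pfree_X.1 (fun _ ↦ hL) (fun hns ↦ absurd hsplit hns) hG hlG (by omega) hpar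
    refine ⟨hunit.unit, ?_⟩
    rw [IsUnit.unit_spec, show (PowerSeries.X : IwasawaAlgebra p) * fE * h = PowerSeries.X * g by
      rw [← hgh]; ring]
    exact hιg
  · -- NON-SPLIT `p`: `λ(1·h·fE) = n ≤ k + 1`, `n + r_an` even
    obtain ⟨hk1, heven⟩ := hkN hns
    obtain ⟨g, hgmem, hιg⟩ := hKns hns L hL
    have hgmem' : g ∈ Ideal.span {fE} := by rw [← hchar]; exact hgmem
    obtain ⟨h, hgh⟩ := Ideal.mem_span_singleton'.mp hgmem'
    have hG : iwasawaToPowerSeries p (1 * (h * fE)) = PowerSeries.C ((ϖ : ℚ) : ℚ_[p]) * L := by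
      rw [one_mul, hgh]; exact hιg
    have hlG : lam (1 * (h * fE)) = n :=
      hlam f hf ϖ hϖ L (fun hsplit ↦ absurd hsplit hns) (fun _ ↦ hL) _ hG
    have hpar : Even (n + 0 + W.analyticRank) := by rw [add_zero]; exact heven
    have hunit : IsUnit h := finish 1 h 0 L one_ne_zero (lam_eq_zero_of_isUnit isUnit_one)
      (X2.mu_eq_zero_of_isUnit isUnit_one) (fun hsplit ↦ absurd hsplit hns) (fun _ ↦ hL) hG hlG
      (by omega) hpar
    refine ⟨hunit.unit, ?_⟩
    rw [IsUnit.unit_spec, show fE * h = g by rw [← hgh]; ring]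
    exact hιg

/-! ## §2. At an X2b pair: Mazur's main conjecture ⟺ μ-part ∧ the v3 parity λ-count -/

/-- **On sub-cell X2b: `X2.MazurMainConjectureAt W p` ⟺ μ-part ∧ (the conclusion of
`stub_lambdaCountParity_offLocus` at the pair)** — i.e. `∃ n k, λ_an = n ∧ λ_alg ≥ k ∧
(¬split → n ≤ k + 1 ∧ Even n) ∧ (split → n ≤ k + 2 ∧ Odd n)`. `←`: §1 with `r_an = 0` and the
non-vanishing of file 1; `→`: the μ-part and the exact λ-count from Mazur's main conjecture
(file 2 §2), the parity of `λ_an` from the Mazur–Tate–Teitelbaum functional equation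
(`X2.analyticLambdaEq_parity`, which needs `ϖ·L ≠ 0` — file 1 again). PUBLISHED by name: `hWu`,
`h310`, `hGZK`, `hpar`, `hGS`. So the v3 re-cut with stub 3′ := μ-part off the locus and stub 4 as
re-cut is EQUIVALENT to the crux at every étale end. [cite: Wuthrich2014, Thm. 16 (p. 397)]
[cite: GreenbergLNM1716, Prop. 3.10] [cite: MazurTateTeitelbaum1986, §I.17] -/
theorem cellB_mazurMainConjectureAt_iff_muPart_and_lambdaCountParity
    (hWu : thm16_charIdeal_dvd_multiplicative_of_reducible)
    (h310 : prop310_selmerCorank_mod_two_eq_lambdaInvariant)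
    (hGZK : rank_eq_analyticRank_of_analyticRank_le_one)
    (hpar : nonempty_modularParametrizationData) (hGS : greenberg_stevens (W := W) (p := p))
    (hc : X2.CellB W p) :
    X2.MazurMainConjectureAt W p ↔
      ((∀ (κ : ZpExtension ℚ p) (γ : Field.absoluteGaloisGroup ℚ),
        κ.IsCyclotomic → κ.IsTopGenerator γ → IsCyclotomicVariable p γ →
        ∀ {N : ℕ} [NeZero N] (f : CuspForm (Gamma0 N) 2), IsNewformOf W f →
        ∀ (ϖ : ℚ), (ϖ : ℝ) * W.realPeriodRat = plusPeriod f →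
        ∀ (L : PowerSeries ℚ_[p]),
          (W.HasSplitMultiplicativeReductionAtPrime p → IsSplitMultPAdicLFunctionOf f p L) →
          (¬ W.HasSplitMultiplicativeReductionAtPrime p → IsMultPAdicLFunctionOf f p (-1) L) →
        ∀ (D : W.SelmerDualData κ γ) (g G : IwasawaAlgebra p), D.charIdeal = Ideal.span {g} →
          iwasawaToPowerSeries p G = PowerSeries.C ((ϖ : ℚ) : ℚ_[p]) * L → mu G ≤ mu g) ∧
      ∃ n k : ℕ, X2.AnalyticLambdaEq W p n ∧ AlgebraicLambdaGE W p k ∧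
        (¬ W.HasSplitMultiplicativeReductionAtPrime p → n ≤ k + 1 ∧ Even n) ∧
        (W.HasSplitMultiplicativeReductionAtPrime p → n ≤ k + 2 ∧ Odd n)) := by
  have hp2 : p ≠ 2 := hc.2.1.1
  have hred : ¬ W.HasIrreducibleModPGaloisRep p := hc.2.1.2.1
  have hmult : W.HasMultiplicativeReductionAtPrime p := hc.2.1.2.2
  have hr0 : W.analyticRank = 0 := hc.1
  have hL0 : ∃ m : ℕ, X2.AnalyticMuLE W p m := exists_analyticMuLE_of_analyticRank_eq_zero hpar hp2 hGS hr0
  constructor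
  · intro hMC
    refine ⟨muPart_of_mazurMainConjectureAt hMC, ?_⟩
    obtain ⟨n, k, hlam, halg, hkN, hkS⟩ :=
      exists_lambdaCount_of_mazurMainConjectureAt_of_analyticRank_eq_zero hpar hp2 hGS hmult hr0 hMC
    obtain ⟨m, hμm⟩ := hL0
    obtain ⟨hev, hod⟩ := X2.analyticLambdaEq_parity hWu hpar W p hp2 hmult hred hμm hlam
    rw [hr0, add_zero] at hev hod
    exact ⟨n, k, hlam, halg, fun hns ↦ ⟨by have := hkN hns; omega, hev hns⟩,
      fun hs ↦ ⟨by have := hkS hs; omega, hod hs⟩⟩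
  · rintro ⟨hμ, n, k, hlam, halg, hkN, hkS⟩
    exact mazurMainConjectureAt_of_muPart_of_lambdaCountParity hWu h310 hGZK W p hp2 hmult hred
      (by rw [hr0]; exact zero_le_one) hL0 hμ hlam halg
      (fun hns ↦ ⟨(hkN hns).1, by rw [hr0, add_zero]; exact (hkN hns).2⟩)
      (fun hs ↦ ⟨(hkS hs).1, by rw [hr0, add_zero]; exact (hkS hs).2⟩)

end Summit.BirchSwinnertonDyer.BirchSwinnertonDyer.Theorems.EisensteinPrimesMazurMCOnCellBMuPartTightParity

end
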